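import Literature.AnabelianGeometry.SemiGraphs.CoveringGraphIsoOver
import Literature.AnabelianGeometry.SemiGraphs.AmbientVocabRealProp43iii
import Literature.AnabelianGeometry.SemiGraphs.SpecialFibreTowerOfCoverings
import HarnessLib

/-!
# [SemiAnbd] Def 3.5 (i): ISOMORPHIC objects of `B^cov(G)` have ISOMORPHIC covering semi-graphs of anabelioids OVER `G`
# (functoriality of `S ↦ (𝒢_S → 𝒢)` on isomorphisms, profinite presentation; proof-only)

Mochizuki, *Semi-graphs of anabelioids*, Publ. RIMS **42** (2006), §3 p. 37, Def 3.5 (i) («we may associate, in a natural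
way, to any object of `B^cov(G)` a morphism of countable semi-graphs of anabelioids `𝒢′ → 𝒢`» — «natural»: the association is
functorial; the choices of base points and conjugators change `𝒢_S` only up to isomorphism over `𝒢`), §2 p. 23 (vertices of
`𝒢′` = connected components, i.e. orbits; constituents = stabilisers, Rmk 2.2.1 p. 24), Rmk 2.4.2 p. 26 («the 1-morphisms
from `𝒢` to `ℋ` form a category, of which `φ` is an object; one can then speak of isomorphisms between various objects of this
category») (kurims `paper:url-f33ace170ff4`). [cite: MochizukiSemiAnbd2006, Def 3.5(i) p.37]

PROOF-ONLY (cell abc-iut, layer L3, seat abc-iut-f-161 gen 9, row «(2e) TOWER ⇒ ONE COVERING» brick (I); no definition, no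
instance, no named fact).  For an isomorphism `e : T ≅ T′` in `B^cov(G)` (abc-iut-L3-t2's `CovObj`), the covering semi-graphs of
anabelioids `𝒢_T → 𝒢` and `𝒢_{T′} → 𝒢` (`CovObj.coveringGraph` / `coveringHom`) are ISOMORPHIC OVER `𝒢`
(abc-iut-L3-t3's `Hom.IsoOver`, B4): `CovObj.nonempty_isoOver_coveringHom_of_iso`.  The isomorphism is abc-iut-L3-t3's
`CovObj.pointIsoOver` for the point system «image under `e` of the chosen base points» — `y_{(v,ω)} := e_v(x_ω)`,
`z_{(f,ω)} := e_f(x_ω)` — whose three conditions are checked here: (PS1) gluing (`CovHom.comm` of `e` and the incidence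
conjugators of `𝒢_T`), (PS2) stabiliser dictionary (`Stab(e x) = Stab(x)` by equivariance and injectivity), (PS3) point alignment
(the incidence conjugator of `𝒢_T` itself aligns), plus properness of `𝔾_T → 𝔾` (`CovObj.isProper_coveringHom`) and the
bijectivity of the point lift on vertices and edges (orbits of `T_v` ↔ orbits of `T′_v` under `e_v`).  A brick towards the
ONE-OBJECT presentation of towers of coverings (the stability of finite étale coverings under composition — the
tree-internal step `remark_2_4_1_covering_of_comp_isFiniteEtaleCoveringGlobal` to which the tree reduces its named fact
`remark_2_4_1_covering`, NOT a statement printed on p. 26 — at the `B^cov(G)` carriers of §3 pp. 36–37: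
`𝒢_{(pre T).left} ≅ 𝒢_T` through abc-iut-L3-d6's `preIso`).  Nothing printed is asserted; no side taken on
[IUTchIII] Cor. 3.12.
-/

noncomputable section

namespace Literature.AnabelianGeometry.SemiGraphs

open CategoryTheory
open Literature.AlgebraicGeometry.Frobenioids.QuasiTemperoid.BTempConnected (hom_ρ ρ_one_apply
  ρ_mul_apply ρ_inv_apply)

universe u

namespace ProfiniteSemiGraph

namespace CovObj

variable {𝒢 : ProfiniteSemiGraph.{u}} {T T' : CovObj 𝒢} (e : T ≅ T')

/-! ## §1. Pointwise bookkeeping for an isomorphism of `B^cov(G)` -/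

/-- `e⁻¹_v (e_v x) = x`. [cite: MochizukiSemiAnbd2006, §3 p.36] -/
theorem iso_inv_hom_apply_V (v : 𝒢.graph.Vertex) (x : (T.SV v).obj.V) :
    ((e.inv.fV v).hom.hom ((e.hom.fV v).hom.hom x) : (T.SV v).obj.V) = x := by
  have h := congrArg (fun k : T ⟶ T => ((k.fV v).hom.hom x : (T.SV v).obj.V)) e.hom_inv_id
  exact h

/-- `e_v (e⁻¹_v x′) = x′`. [cite: MochizukiSemiAnbd2006, §3 p.36] -/
theorem iso_hom_inv_apply_V (v : 𝒢.graph.Vertex) (x' : (T'.SV v).obj.V) :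
    ((e.hom.fV v).hom.hom ((e.inv.fV v).hom.hom x') : (T'.SV v).obj.V) = x' := by
  have h := congrArg (fun k : T' ⟶ T' => ((k.fV v).hom.hom x' : (T'.SV v).obj.V)) e.inv_hom_id
  exact h

/-- `e⁻¹_f (e_f t) = t`. [cite: MochizukiSemiAnbd2006, §3 p.36] -/
theorem iso_inv_hom_apply_E (f : 𝒢.graph.Edge) (t : (T.SE f).obj.V) :
    ((e.inv.fE f).hom.hom ((e.hom.fE f).hom.hom t) : (T.SE f).obj.V) = t := by
  have h := congrArg (fun k : T ⟶ T => ((k.fE f).hom.hom t : (T.SE f).obj.V)) e.hom_inv_id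
  exact h

/-- `e_f (e⁻¹_f t′) = t′`. [cite: MochizukiSemiAnbd2006, §3 p.36] -/
theorem iso_hom_inv_apply_E (f : 𝒢.graph.Edge) (t' : (T'.SE f).obj.V) :
    ((e.hom.fE f).hom.hom ((e.inv.fE f).hom.hom t') : (T'.SE f).obj.V) = t' := by
  have h := congrArg (fun k : T' ⟶ T' => ((k.fE f).hom.hom t' : (T'.SE f).obj.V)) e.inv_hom_id
  exact h

/-- `e_v` is injective. [cite: MochizukiSemiAnbd2006, §3 p.36] -/
theorem iso_hom_injective_V (v : 𝒢.graph.Vertex) :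
    Function.Injective fun x : (T.SV v).obj.V => ((e.hom.fV v).hom.hom x : (T'.SV v).obj.V) := fun x x' h => by
  have h' := congrArg (fun y : (T'.SV v).obj.V => ((e.inv.fV v).hom.hom y : (T.SV v).obj.V)) h
  simpa only [iso_inv_hom_apply_V] using h'

/-- `e_f` is injective. [cite: MochizukiSemiAnbd2006, §3 p.36] -/
theorem iso_hom_injective_E (f : 𝒢.graph.Edge) :
    Function.Injective fun t : (T.SE f).obj.V => ((e.hom.fE f).hom.hom t : (T'.SE f).obj.V) := fun t t' h => by
  have h' := congrArg (fun y : (T'.SE f).obj.V => ((e.inv.fE f).hom.hom y : (T.SE f).obj.V)) h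
  simpa only [iso_inv_hom_apply_E] using h'

/-- **`Stab(e_v x) = Stab(x)`** (equivariance and injectivity). [cite: MochizukiSemiAnbd2006, Rem. 2.2.1 p.24] -/
theorem stab_iso_hom_V (v : 𝒢.graph.Vertex) (x : (T.SV v).obj.V) :
    BTemp.stab (T'.SV v) ((e.hom.fV v).hom.hom x) = BTemp.stab (T.SV v) x := by
  ext g
  change (T'.SV v).obj.ρ g ((e.hom.fV v).hom.hom x) = (e.hom.fV v).hom.hom x ↔ (T.SV v).obj.ρ g x = x
  rw [← hom_ρ]
  exact ⟨fun h => (iso_hom_injective_V e) v h, fun h => by rw [h]⟩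

/-- **`Stab(e_f t) = Stab(t)`**. [cite: MochizukiSemiAnbd2006, Rem. 2.2.1 p.24] -/
theorem stab_iso_hom_E (f : 𝒢.graph.Edge) (t : (T.SE f).obj.V) :
    BTemp.stab (T'.SE f) ((e.hom.fE f).hom.hom t) = BTemp.stab (T.SE f) t := by
  ext g
  change (T'.SE f).obj.ρ g ((e.hom.fE f).hom.hom t) = (e.hom.fE f).hom.hom t ↔ (T.SE f).obj.ρ g t = t
  rw [← hom_ρ]
  exact ⟨fun h => (iso_hom_injective_E e) f h, fun h => by rw [h]⟩

/-- `e` commutes with the gluings, pointwise: `glue′_b (e_f t) = e_v (glue_b t)` (`CovHom.comm`).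
[cite: MochizukiSemiAnbd2006, §3 p.36] -/
theorem glue_iso_hom_apply (b : 𝒢.graph.Branch) (v : 𝒢.graph.Vertex) (h : 𝒢.graph.abuts b = some v)
    (t : (T.SE (𝒢.graph.edgeOf b)).obj.V) :
    ((T'.glue b v h).hom.hom.hom ((e.hom.fE (𝒢.graph.edgeOf b)).hom.hom t) : (T'.SV v).obj.V) =
      (e.hom.fV v).hom.hom ((T.glue b v h).hom.hom.hom t) := by
  have hc := congrArg (fun k : T.SE (𝒢.graph.edgeOf b) ⟶ (BTemp.res (𝒢.brHom b v h)).obj (T'.SV v) =>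
    (k.hom.hom t : (T'.SV v).obj.V)) (e.hom.comm b v h)
  exact hc

/-- `e` carries orbits to orbits: `[e_v x] = [e_v x′] ↔ [x] = [x′]`. [cite: MochizukiSemiAnbd2006, §2 p.23] -/
theorem cl_iso_hom_eq_iff_V (v : 𝒢.graph.Vertex) (x x' : (T.SV v).obj.V) :
    BTemp.cl (T'.SV v) ((e.hom.fV v).hom.hom x) = BTemp.cl (T'.SV v) ((e.hom.fV v).hom.hom x') ↔
      BTemp.cl (T.SV v) x = BTemp.cl (T.SV v) x' := by
  rw [BTemp.cl_eq_cl_iff, BTemp.cl_eq_cl_iff]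
  constructor
  · rintro ⟨g, hg⟩
    rw [← hom_ρ] at hg
    exact ⟨g, (iso_hom_injective_V e) v hg⟩
  · rintro ⟨g, rfl⟩
    exact ⟨g, (hom_ρ _ _ _).symm⟩

/-- … and on edges. [cite: MochizukiSemiAnbd2006, §2 p.23] -/
theorem cl_iso_hom_eq_iff_E (f : 𝒢.graph.Edge) (t t' : (T.SE f).obj.V) :
    BTemp.cl (T'.SE f) ((e.hom.fE f).hom.hom t) = BTemp.cl (T'.SE f) ((e.hom.fE f).hom.hom t') ↔
      BTemp.cl (T.SE f) t = BTemp.cl (T.SE f) t' := by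
  rw [BTemp.cl_eq_cl_iff, BTemp.cl_eq_cl_iff]
  constructor
  · rintro ⟨g, hg⟩
    rw [← hom_ρ] at hg
    exact ⟨g, (iso_hom_injective_E e) f hg⟩
  · rintro ⟨g, rfl⟩
    exact ⟨g, (hom_ρ _ _ _).symm⟩

/-! ## §2. The point system «image of the base points» and its three conditions -/

/-- **(PS1) gluing condition** for `y_{(v,ω)} := e_v(x_ω)`, `z_{(f,ω)} := e_f(x_ω)` over `𝔾_T → 𝔾`: along the branch-orbit
`(b, ω)` abutting to `(v, ω_v)`, `glue′_b(e_f x_ω) = e_v(glue_b x_ω) = e_v(c⁻¹ · x_{ω_v})` lies in the orbit of `e_v(x_{ω_v})`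
(`c` the incidence conjugator of `𝒢_T`). [cite: MochizukiSemiAnbd2006, Def 3.5(i) p.37] -/
theorem glueCondition_iso_hom :
    T'.GlueCondition T.coveringHom.base (fun ν => (e.hom.fV ν.1).hom.hom (Quot.out ν.2))
      (fun ε => (e.hom.fE ε.1).hom.hom (Quot.out ε.2)) := by
  refine ⟨fun β ν h => ?_⟩
  obtain ⟨b, ω⟩ := β
  obtain ⟨v, ωv⟩ := ν
  have hc := T.conjugator_spec h
  change BTemp.cl (T'.SV v) ((T'.glue b v (T.abuts_of_coveringAbuts h)).hom.hom.hom
      ((e.hom.fE (𝒢.graph.edgeOf b)).hom.hom (Quot.out ω))) = BTemp.cl (T'.SV v) ((e.hom.fV v).hom.hom (Quot.out ωv))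
  rw [glue_iso_hom_apply, cl_iso_hom_eq_iff_V, BTemp.cl_eq_cl_iff]
  exact ⟨T.conjugator h, hc⟩

/-- **(PS2) stabiliser dictionary**: the constituent of `𝒢_T → 𝒢` at `(v, ω)` is the inclusion of `Stab(x_ω) = Stab(e_v x_ω)`.
[cite: MochizukiSemiAnbd2006, Rem. 2.2.1 p.24] -/
theorem stabCondition_iso_hom :
    StabCondition T.coveringHom T' (fun ν => (e.hom.fV ν.1).hom.hom (Quot.out ν.2))
      (fun ε => (e.hom.fE ε.1).hom.hom (Quot.out ε.2)) := by
  refine ⟨fun ν => Subtype.val_injective, fun ν => ?_, fun ε => Subtype.val_injective, fun ε => ?_⟩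
  · change (BTemp.stab (T.SV ν.1) (Quot.out ν.2)).subtype.range = BTemp.stab (T'.SV ν.1) ((e.hom.fV ν.1).hom.hom (Quot.out ν.2))
    rw [Subgroup.range_subtype, stab_iso_hom_V]
  · change (BTemp.stab (T.SE ε.1) (Quot.out ε.2)).subtype.range = BTemp.stab (T'.SE ε.1) ((e.hom.fE ε.1).hom.hom (Quot.out ε.2))
    rw [Subgroup.range_subtype, stab_iso_hom_E]

/-- **(PS3) point alignment**: the incidence conjugator `c` of `𝒢_T` at `(b, ω) ↦ (v, ω_v)` conjugates the square of `𝒢_T → 𝒢`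
(by construction of `𝒢_T`) and carries `glue′_b(e_f x_ω) = e_v(c⁻¹ x_{ω_v})` to `e_v(x_{ω_v})`.
[cite: MochizukiSemiAnbd2006, Def 3.5(i) p.37] -/
theorem pointAligned_iso_hom :
    PointAligned T.coveringHom T' (fun ν => (e.hom.fV ν.1).hom.hom (Quot.out ν.2))
      (fun ε => (e.hom.fE ε.1).hom.hom (Quot.out ε.2)) := by
  refine ⟨fun β ν h => ?_⟩
  obtain ⟨b, ω⟩ := β
  obtain ⟨v, ωv⟩ := ν
  have hc := T.conjugator_spec h
  refine ⟨T.conjugator h, fun x => rfl, ?_⟩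
  change (T'.SV v).obj.ρ (T.conjugator h) ((T'.glue b v (T.abuts_of_coveringAbuts h)).hom.hom.hom
      ((e.hom.fE (𝒢.graph.edgeOf b)).hom.hom (Quot.out ω))) = (e.hom.fV v).hom.hom (Quot.out ωv)
  rw [glue_iso_hom_apply, ← hom_ρ, hc]

/-! ## §3. Bijectivity of the point lift; the isomorphism over `𝒢` -/

/-- The point lift `𝔾_T → 𝔾_{T′}`, `(v, ω) ↦ (v, [e_v x_ω])`, is bijective on vertices. [cite: MochizukiSemiAnbd2006, §2 p.23] -/
theorem pointLift_iso_hom_vertexMap_bijective :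
    Function.Bijective (T'.pointLift T.coveringHom.base (fun ν => (e.hom.fV ν.1).hom.hom (Quot.out ν.2))
      (fun ε => (e.hom.fE ε.1).hom.hom (Quot.out ε.2)) (glueCondition_iso_hom e)).vertexMap := by
  constructor
  · rintro ⟨v, ω⟩ ⟨v', ω'⟩ h
    rw [pointLift_vertexMap, pointLift_vertexMap] at h
    obtain ⟨h1, h2⟩ := Sigma.mk.inj_iff.mp h
    change v = v' at h1
    subst h1
    have h3 := eq_of_heq h2
    change BTemp.cl (T'.SV v) ((e.hom.fV v).hom.hom (Quot.out ω)) =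
      BTemp.cl (T'.SV v) ((e.hom.fV v).hom.hom (Quot.out ω')) at h3
    rw [cl_iso_hom_eq_iff_V] at h3
    have hω : ω = ω' := by rw [← Quot.out_eq ω, ← Quot.out_eq ω']; exact h3
    rw [hω]
  · rintro ⟨v, ω'⟩
    induction ω' using Quot.ind with
    | mk t' =>
      refine ⟨⟨v, BTemp.cl (T.SV v) ((e.inv.fV v).hom.hom t')⟩, ?_⟩
      rw [pointLift_vertexMap]
      change (⟨v, BTemp.cl (T'.SV v) ((e.hom.fV v).hom.hom
        (Quot.out (BTemp.cl (T.SV v) ((e.inv.fV v).hom.hom t'))))⟩ : T'.coveringSemiGraph.Vertex) = ⟨v, BTemp.cl (T'.SV v) t'⟩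
      congr 1
      conv_rhs => rw [← (iso_hom_inv_apply_V e) v t']
      rw [cl_iso_hom_eq_iff_V]
      exact Quot.out_eq _

/-- … and on edges. [cite: MochizukiSemiAnbd2006, §2 p.23] -/
theorem pointLift_iso_hom_edgeMap_bijective :
    Function.Bijective (T'.pointLift T.coveringHom.base (fun ν => (e.hom.fV ν.1).hom.hom (Quot.out ν.2))
      (fun ε => (e.hom.fE ε.1).hom.hom (Quot.out ε.2)) (glueCondition_iso_hom e)).edgeMap := by
  constructor
  · rintro ⟨f, ω⟩ ⟨f', ω'⟩ h
    rw [pointLift_edgeMap, pointLift_edgeMap] at h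
    obtain ⟨h1, h2⟩ := Sigma.mk.inj_iff.mp h
    change f = f' at h1
    subst h1
    have h3 := eq_of_heq h2
    change BTemp.cl (T'.SE f) ((e.hom.fE f).hom.hom (Quot.out ω)) =
      BTemp.cl (T'.SE f) ((e.hom.fE f).hom.hom (Quot.out ω')) at h3
    rw [cl_iso_hom_eq_iff_E] at h3
    have hω : ω = ω' := by rw [← Quot.out_eq ω, ← Quot.out_eq ω']; exact h3
    rw [hω]
  · rintro ⟨f, ω'⟩
    induction ω' using Quot.ind with
    | mk t' =>
      refine ⟨⟨f, BTemp.cl (T.SE f) ((e.inv.fE f).hom.hom t')⟩, ?_⟩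
      rw [pointLift_edgeMap]
      change (⟨f, BTemp.cl (T'.SE f) ((e.hom.fE f).hom.hom
        (Quot.out (BTemp.cl (T.SE f) ((e.inv.fE f).hom.hom t'))))⟩ : T'.coveringSemiGraph.Edge) = ⟨f, BTemp.cl (T'.SE f) t'⟩
      congr 1
      conv_rhs => rw [← (iso_hom_inv_apply_E e) f t']
      rw [cl_iso_hom_eq_iff_E]
      exact Quot.out_eq _

/-- **Isomorphic objects of `B^cov(G)` have isomorphic covering semi-graphs of anabelioids OVER `G`**: for `e : T ≅ T′`
there is an isomorphism over `𝒢` (abc-iut-L3-t3's `Hom.IsoOver`: underlying isomorphism of semi-graphs, bijective constituents,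
lying over `𝒢`, compatible with the structure morphisms up to inner automorphisms) between `𝒢_T → 𝒢` and `𝒢_{T′} → 𝒢` — the
«natural way» of Def 3.5 (i) is natural in `T`. [cite: MochizukiSemiAnbd2006, Def 3.5(i) p.37] -/
theorem nonempty_isoOver_coveringHom_of_iso (e : T ≅ T') : Nonempty (Hom.IsoOver T.coveringHom T'.coveringHom) :=
  ⟨pointIsoOver T.coveringHom T' (fun ν => (e.hom.fV ν.1).hom.hom (Quot.out ν.2))
    (fun ε => (e.hom.fE ε.1).hom.hom (Quot.out ε.2)) (glueCondition_iso_hom e) (stabCondition_iso_hom e)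
    (pointAligned_iso_hom e) T.isProper_coveringHom (pointLift_iso_hom_vertexMap_bijective e)
    (pointLift_iso_hom_edgeMap_bijective e)⟩

end CovObj

end ProfiniteSemiGraph

end Literature.AnabelianGeometry.SemiGraphs

end
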